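import Mathlib
import Summits.ResolutionOfSingularities.ResolutionOfSingularities.Theorems.WeightedInvariantHypersurfaceCentreAssemblyPrimeT

/-!
# IOTA3-DESIGN calibration rows — TOOL: coefficientwise Leibniz maps (`∂/∂z`) of `S[t, t⁻¹]` preserve the game-side carrier
# `S[t⁻¹, 𝒥ₙ(u, w) tⁿ]` when they kill the positively weighted parameters (door crux `HypersurfaceCentreConstruction`)

Door crux item stmt-ResolutionOfSingularities-19897 `Theses.WeightedInvariant.HypersurfaceCentreConstruction` (route
`ResolutionOfSingularities/WeightedInvariant`), line `local-engine`, P3 rung design (IOTA3-DESIGN, res-L1-w43-plan-1).  [OURS · L1 W4.3 ·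
res-type-088 (g8) on res-L1-w43-plan-1 DEALS gen 10 #4 (3) / #6 (4) «DOOR-SIDE CALIBRATION ROW WHITNEY-CYLINDER»; `--supports 19897 --as helper`,
counted 0; definition-free; NOT a statement of H. Hironaka's manuscript; AI-written (gate-accepted = sorry-free with standard axioms, not
refereed).]  Part 1 of 2: the DERIVATION TOOL used by the Jacobian-type argument «a singular successor `g ∈ 𝔪_𝔫²` forces `D g ∈ 𝔫`» of the
calibration rows (part 2: `…Iota3CalibrationWhitneyCylinder`).

* §1 `leibniz_map_one`, `map_C_mul_T`, `coeff_map_apply`, **`map_mul_leibniz`** — the coefficientwise extension `Σ aₙtⁿ ↦ Σ δ(aₙ)tⁿ`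
  (`AddMonoidAlgebra.map δ`) of an additive Leibniz map `δ` of `S` is Leibniz on the Laurent polynomials `S[t, t⁻¹]`;
* §2 **`leibniz_mem_weightedMonomialIdeal`** — a Leibniz map killing the POSITIVELY weighted parameters `uᵢ` (`wᵢ > 0`) preserves every
  weighted monomial ideal `𝒥ₘ(u, w)` (Włodarczyk's `(u^α : Σ wᵢαᵢ ≥ m)`); **`map_mem_cobordantAlgebra'`** — then its coefficientwise extension
  preserves the carrier `cobordantAlgebra' u w = S[t⁻¹, 𝒥ₙ tⁿ]` (coefficientwise criterion `IdealFiltration.mem_extendedRees_iff` of the bridge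
  `extReesAlgebra (𝒥ₙ(u,w)) = (weightedFiltration u w).extendedRees`).

References: J. Włodarczyk, *Functorial resolution by torus actions*, arXiv:2203.03090, Def. 2.3.5 [Wlodarczyk2022]; tree files
`…HypersurfaceLocalGameEFT` (`cobordantAlgebra'`), `Literature/…/CobordantBlowupExtReesBridge`, `…CobordantBlowupFiltration`.
-/

noncomputable section

set_option linter.dupNamespace false -- mandated namespace of this single-conjunct summit

open scoped LaurentPolynomial
open LaurentPolynomial IsLocalRing Literature.AlgebraicGeometry.Resolution

namespace Summit.ResolutionOfSingularities.ResolutionOfSingularities.Cruxes.HypersurfaceCentreConstruction.LocalEngine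

namespace Iota3Calibration

variable {S : Type} [CommRing S]

/-! ## §1 Coefficientwise Leibniz maps of Laurent polynomials -/

/-- An additive Leibniz map kills `1`. -/
theorem leibniz_map_one (δ : S →+ S) (hL : ∀ a b : S, δ (a * b) = a * δ b + b * δ a) : δ 1 = 0 := by
  have h := hL 1 1
  rw [one_mul, one_mul] at h
  -- `δ 1 = δ 1 + δ 1`
  have : δ 1 + δ 1 = δ 1 + 0 := by rw [add_zero]; exact h.symm
  exact add_left_cancel this

/-- The coefficientwise extension `Σ aₙ tⁿ ↦ Σ δ(aₙ) tⁿ` on a monomial `a tⁿ`. -/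
theorem map_C_mul_T (δ : S →+ S) (a : S) (n : ℤ) :
    AddMonoidAlgebra.map δ (C a * T n) = C (δ a) * T n := by
  rw [← single_eq_C_mul_T, ← single_eq_C_mul_T, AddMonoidAlgebra.map_single]

/-- … its coefficients. -/
theorem coeff_map_apply (δ : S →+ S) (p : S[T;T⁻¹]) (m : ℤ) : (AddMonoidAlgebra.map δ p).coeff m = δ (p.coeff m) := by
  rw [AddMonoidAlgebra.coeff_map, Finsupp.mapRange_apply]

/-- **The coefficientwise extension of an additive Leibniz map is Leibniz on `S[t, t⁻¹]`.** -/
theorem map_mul_leibniz (δ : S →+ S) (hL : ∀ a b : S, δ (a * b) = a * δ b + b * δ a) (p q : S[T;T⁻¹]) :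
    AddMonoidAlgebra.map δ (p * q) = p * AddMonoidAlgebra.map δ q + q * AddMonoidAlgebra.map δ p := by
  induction p using LaurentPolynomial.induction_on' with
  | add p₁ p₂ h₁ h₂ =>
    rw [add_mul, AddMonoidAlgebra.map_add, h₁, h₂, AddMonoidAlgebra.map_add, add_mul, mul_add]
    abel
  | C_mul_T n a =>
    induction q using LaurentPolynomial.induction_on' with
    | add q₁ q₂ h₁ h₂ =>
      rw [mul_add, AddMonoidAlgebra.map_add, h₁, h₂, AddMonoidAlgebra.map_add, add_mul, mul_add]
      abel
    | C_mul_T m b =>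
      have hmul : ∀ (a b : S) (n m : ℤ), C a * T n * (C b * T m) = C (a * b) * T (n + m) := by
        intro a b n m
        rw [map_mul, T_add]; ring
      rw [hmul, map_C_mul_T, map_C_mul_T, map_C_mul_T, hmul, hmul, hL, map_add, add_mul, add_comm m n, mul_comm b (δ a)]

/-! ## §2 Stability of the game-side carrier `S[t⁻¹, 𝒥ₙ tⁿ]` under a Leibniz map preserving the filtration -/

variable {n : ℕ} (u : Fin n → S) (w : Fin n → ℕ)

/-- If `δ` preserves every `𝒥ₙ(u, w)`, its coefficientwise extension preserves `S[t⁻¹, 𝒥ₙ tⁿ]` (coefficientwise criterion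
of the bridge file). -/
theorem map_mem_cobordantAlgebra' (δ : S →+ S) (hI : ∀ (m : ℕ) (a : S), a ∈ weightedMonomialIdeal u w m → δ a ∈ weightedMonomialIdeal u w m)
    {b : S[T;T⁻¹]} (hb : b ∈ extReesAlgebra (weightedMonomialIdeal u w)) :
    AddMonoidAlgebra.map δ b ∈ extReesAlgebra (weightedMonomialIdeal u w) := by
  rw [extReesAlgebra_weightedMonomialIdeal_eq_extendedRees, IdealFiltration.mem_extendedRees_iff] at hb ⊢
  intro m
  rw [coeff_map_apply, ← weightedMonomialIdeal_eq_weightedFiltration_ideal]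
  have h := hb m
  rw [← weightedMonomialIdeal_eq_weightedFiltration_ideal] at h
  exact hI m _ h

/-- A Leibniz map killing the POSITIVELY weighted parameters preserves every weighted monomial ideal `𝒥ₘ(u, w)`:
on a generator `u^α = (∏_{wᵢ>0} uᵢ^{αᵢ}) · (∏_{wᵢ=0} uᵢ^{αᵢ})` the first factor is killed and lies in `𝒥ₘ`. -/
theorem leibniz_mem_weightedMonomialIdeal (δ : S →+ S) (hL : ∀ a b : S, δ (a * b) = a * δ b + b * δ a)
    (hδ : ∀ i, 0 < w i → δ (u i) = 0) (m : ℕ) (a : S) (ha : a ∈ weightedMonomialIdeal u w m) :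
    δ a ∈ weightedMonomialIdeal u w m := by
  classical
  -- products of killed elements are killed
  have hkill_mul : ∀ a b : S, δ a = 0 → δ b = 0 → δ (a * b) = 0 := fun a b ha hb => by rw [hL, ha, hb, mul_zero, mul_zero, add_zero]
  have hkill_pow : ∀ (a : S) (k : ℕ), δ a = 0 → δ (a ^ k) = 0 := by
    intro a k ha
    induction k with
    | zero => rw [pow_zero]; exact leibniz_map_one δ hL
    | succ k ih => rw [pow_succ]; exact hkill_mul _ _ ih ha
  have hkill_prod : ∀ (s : Finset (Fin n)) (f : Fin n → S), (∀ i ∈ s, δ (f i) = 0) → δ (∏ i ∈ s, f i) = 0 := by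
    intro s f hf
    induction s using Finset.induction_on with
    | empty => rw [Finset.prod_empty]; exact leibniz_map_one δ hL
    | insert i s hi ih =>
      rw [Finset.prod_insert hi]
      exact hkill_mul _ _ (hf i (Finset.mem_insert_self _ _)) (ih fun j hj => hf j (Finset.mem_insert_of_mem hj))
  unfold weightedMonomialIdeal at ha ⊢
  refine Submodule.span_induction (p := fun a _ => δ a ∈ Ideal.span {x | ∃ α : Fin n → ℕ, m ≤ ∑ i, w i * α i ∧ x = ∏ i, u i ^ α i})
    ?_ ?_ ?_ ?_ ha
  · rintro x ⟨α, hα, rfl⟩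
    -- split the monomial into its positively weighted part `P` and the rest `Q`
    set s : Finset (Fin n) := Finset.univ.filter (fun i => 0 < w i) with hs
    have hsplit : ∏ i, u i ^ α i = (∏ i ∈ s, u i ^ α i) * ∏ i ∈ Finset.univ.filter (fun i => ¬ 0 < w i), u i ^ α i := by
      rw [hs, Finset.prod_filter_mul_prod_filter_not]
    have hP0 : δ (∏ i ∈ s, u i ^ α i) = 0 :=
      hkill_prod s _ fun i hi => hkill_pow _ _ (hδ i (Finset.mem_filter.mp hi).2)
    -- the positively weighted part is itself a generator of weight `Σ wᵢ αᵢ`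
    have hPmem : (∏ i ∈ s, u i ^ α i) ∈ Ideal.span {x | ∃ α : Fin n → ℕ, m ≤ ∑ i, w i * α i ∧ x = ∏ i, u i ^ α i} := by
      refine Ideal.subset_span ⟨fun i => if 0 < w i then α i else 0, ?_, ?_⟩
      · refine hα.trans (le_of_eq (Finset.sum_congr rfl fun i _ => ?_))
        simp only []
        split_ifs with h
        · rfl
        · have h0 : w i = 0 := by omega
          rw [h0, zero_mul, zero_mul]
      · rw [hs, Finset.prod_filter]
        refine Finset.prod_congr rfl fun i _ => ?_
        simp only []
        split_ifs with h
        · rfl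
        · rw [pow_zero]
    rw [hsplit, hL, hP0, mul_zero, add_zero]
    exact Ideal.mul_mem_right _ _ hPmem
  · rw [map_zero]; exact Ideal.zero_mem _
  · intro x y _ _ hx hy
    rw [map_add]; exact Ideal.add_mem _ hx hy
  · intro s x hx hδx
    rw [smul_eq_mul, hL]
    exact Ideal.add_mem _ (Ideal.mul_mem_left _ _ hδx) (Ideal.mul_mem_right _ _ hx)

end Iota3Calibration

end Summit.ResolutionOfSingularities.ResolutionOfSingularities.Cruxes.HypersurfaceCentreConstruction.LocalEngine

end
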